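import Summits.MatrixMultiplication.MatrixMultiplication.Theorems.EdgePencilExponent
import HarnessLib

/-!
# The single-edge pencil is rectangular: `P_n^{(d₁d₂)} ≤ ⟨n, d₁, n⟩ ⊠ ⟨n, d₂, n⟩`, hence `ψ(ε) = ω(2,ε,2)`

Support kernel for `stmt-MatrixMultiplication-33477` (`TetraFlat`) of route `TetrahedronCarving`
(lineage `decomp-mm-lens-6`, generation 20), sequel of `EdgePencilCore` / `EdgePencilExponent`.

§1 (finite, every field). The diamond `K₄ - 01` is the union of the two triangles `023` and `123`
glued along the edge `23`; as GRAPH TENSORS WITH BOND DIMENSIONS the gluing multiplies the bonds on the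
shared edge, so for every factorisation the pencil is a Kronecker product of two rectangular matrix
multiplication tensors: `P_n^{(d)} ≤ ⟨n, d₁, n⟩₀₂₃ ⊠ ⟨n, d₂, n⟩₁₂₃` whenever `d ≤ d₁ d₂` (the label of
the edge `23` is split into its residue and quotient mod `d₁`). We give the explicit rank-one
decomposition (`pencil_eq_sum_twoTriangles`) and `R₄(P_n^{(d)}) ≤ R(⟨n,d₁,n⟩) · R(⟨n,d₂,n⟩)`.

§2 (exponents). With `d₁ = d₂ = ⌈n^{ε/2}⌉`: `ψ(ε) ≤ 2·ω(1,ε/2,1) = ω(2,ε,2)`, which is the grouping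
floor of `EdgePencilExponent`; so **`ψ(ε) = ω(2,ε,2) = 2·ω(1,ε/2,1)` exactly** (`0 ≤ ε ≤ 1`): deleting
one edge of `K₄` collapses the carving onto the rectangular profile `k ↦ ω(1,k,1)` at `k = ε/2`.

§3 (consequences for the diamond cut `ω = 2 ⟺ ψ(1) ≤ 4 ∧ ω + 2 ≤ ψ(1)` of `EdgePencilExponent`).
`DiamondFlat ⟺ α ≥ 1/2` EXACTLY (`ψ(1) ≤ 4 ⟺ ω(1,1/2,1) = 2`), the rung frontier of the pencil is
exactly `2α ∧ 1` (`ψ(ε) ≤ 4 ⟺ ε/2 ≤ α`), and the cover-priced residual `ω + 2 ≤ ψ(1) = 2ω(1,1/2,1)` says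
that the midpoint of the convex profile lies on its chord — by the three-slope argument of
`EdgePencilExponent.omega_eq_two_of_chord_le_omegaRect` (given `α > 0`, Coppersmith 1982) it is the summit
in COSTUME. Net: the diamond cut degenerates to the classical trivial-seam split
`ω = 2 ⟺ (α ≥ 1/2) ∧ (α ≥ 1/2 → ω = 2)`; among the spanning subgraphs of `K₄` only the full tetrahedron
carries a non-rectangular flatness statement (`TetraFlat`), i.e. the carving of record is edge-minimal.
(The independence models of `EdgePencilWeb` are relative to the five inequalities recorded BEFORE this
file; the identity `ψ(1) = 2ω(1,1/2,1)` is the sixth, and it decides the residual.)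

References: Christandl–Vrana–Zuiddam, arXiv:1609.07476, Ex. 1.1.2, Prop. 1.1.16 (graph tensors multiply
edge-wise), Prop. 1.1.26; Lotti–Romani 1983 (`ω(1,k,1)`, homogeneity); Coppersmith 1982 (`α > 0`).
[ChristandlVranaZuiddam2016] [LottiRomani1983] [Coppersmith1982]
-/

noncomputable section

set_option linter.dupNamespace false

open scoped BigOperators
open Filter Asymptotics
open Literature.Computability.AlgebraicComplexity
open Summit.MatrixMultiplication.MatrixMultiplication.Theorems.TetrahedronTensor
open Summit.MatrixMultiplication.MatrixMultiplication.Theorems.TetraDiagonal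

namespace Summit.MatrixMultiplication.MatrixMultiplication.Theorems.EdgePencil

/-! ## §1 The two-triangle decomposition of the pencil -/

section TwoTriangles

variable {F : Type*} [Field F]

/-- Residue of a label mod `d₁`, as a label. -/
def modLab {n : ℕ} (d₁ : ℕ) (y : Fin n) : Fin n := ⟨(y : ℕ) % d₁, (Nat.mod_le _ _).trans_lt y.2⟩

/-- Quotient of a label by `d₁`, as a label. -/
def divLab {n : ℕ} (d₁ : ℕ) (y : Fin n) : Fin n := ⟨(y : ℕ) / d₁, (Nat.div_le_self _ _).trans_lt y.2⟩

/-- Value of `modLab`. -/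
@[simp] theorem coe_modLab {n : ℕ} (d₁ : ℕ) (y : Fin n) : ((modLab d₁ y : Fin n) : ℕ) = y % d₁ := rfl

/-- Value of `divLab`. -/
@[simp] theorem coe_divLab {n : ℕ} (d₁ : ℕ) (y : Fin n) : ((divLab d₁ y : Fin n) : ℕ) = y / d₁ := rfl

/-- A label is determined by its residue and quotient. -/
theorem modLab_eq_and_divLab_eq_iff {n : ℕ} (d₁ : ℕ) (y y' : Fin n) :
    (modLab d₁ y = modLab d₁ y' ∧ divLab d₁ y = divLab d₁ y') ↔ y = y' := by
  constructor
  · rintro ⟨h1, h2⟩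
    have h1' : (y : ℕ) % d₁ = y' % d₁ := by simpa using congrArg Fin.val h1
    have h2' : (y : ℕ) / d₁ = y' / d₁ := by simpa using congrArg Fin.val h2
    exact Fin.ext (by rw [← Nat.div_add_mod (y : ℕ) d₁, ← Nat.div_add_mod (y' : ℕ) d₁, h1', h2'])
  · rintro rfl
    exact ⟨rfl, rfl⟩

/-- The four legs of the two-triangle summand indexed by `s = (k, k')`: `k` a triad index of
`⟨n, d₁, n⟩` (triangle `023`, the edge `23` read mod `d₁`), `k'` one of `⟨n, d₂, n⟩` (triangle `123`,
the edge `23` read div `d₁`); the pencil's own thinness `[label₂₃ < d]` rides on vertex `2`.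
(CVZ19 Prop. 1.1.16: graph tensors multiply edge-wise.) -/
def twoTriLeg {n d₁ d₂ r₁ r₂ : ℕ} (d : ℕ) (w₁ : Fin r₁ → Fin n × Fin n → F)
    (u₁ : Fin r₁ → Fin n × Fin d₁ → F) (v₁ : Fin r₁ → Fin d₁ × Fin n → F)
    (w₂ : Fin r₂ → Fin n × Fin n → F) (u₂ : Fin r₂ → Fin n × Fin d₂ → F)
    (v₂ : Fin r₂ → Fin d₂ × Fin n → F) (s : Fin r₁ × Fin r₂) : Fin 4 → Fin (n ^ 3) → F :=
  ![fun x => ind ((lab x 0 : ℕ) < 1) * w₁ s.1 (lab x 1, lab x 2),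
    fun x => ind ((lab x 0 : ℕ) < 1) * w₂ s.2 (lab x 1, lab x 2),
    fun x => ind ((lab x 2 : ℕ) < d) * (extMid (u₁ s.1) (lab x 0) (modLab d₁ (lab x 2)) *
      extMid (u₂ s.2) (lab x 1) (divLab d₁ (lab x 2))),
    fun x => extFst (v₁ s.1) (modLab d₁ (lab x 2)) (lab x 0) *
      extFst (v₂ s.2) (divLab d₁ (lab x 2)) (lab x 1)]

/-- **The two-triangle decomposition**: from `⟨n, d₁, n⟩ = ∑_k w₁ ⊗ u₁ ⊗ v₁` and
`⟨n, d₂, n⟩ = ∑_{k'} w₂ ⊗ u₂ ⊗ v₂` and `d ≤ d₁ d₂`,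
`P_n^{(d)} = ∑_{(k,k')} ⊗_v twoTriLeg_{(k,k')}(v)` (`r₁ r₂` rank-one terms).
[cite: ChristandlVranaZuiddam2016, Prop. 1.1.16, Prop. 1.1.26] -/
theorem pencil_eq_sum_twoTriangles {n d d₁ d₂ r₁ r₂ : ℕ} (hd : d ≤ d₁ * d₂)
    {w₁ : Fin r₁ → Fin n × Fin n → F} {u₁ : Fin r₁ → Fin n × Fin d₁ → F}
    {v₁ : Fin r₁ → Fin d₁ × Fin n → F} {w₂ : Fin r₂ → Fin n × Fin n → F}
    {u₂ : Fin r₂ → Fin n × Fin d₂ → F} {v₂ : Fin r₂ → Fin d₂ × Fin n → F}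
    (hdec₁ : matMulTensor F n d₁ n = ∑ j, triad (w₁ j) (u₁ j) (v₁ j))
    (hdec₂ : matMulTensor F n d₂ n = ∑ j, triad (w₂ j) (u₂ j) (v₂ j)) :
    ∑ s : Fin r₁ × Fin r₂, rankOneTensor (twoTriLeg d w₁ u₁ v₁ w₂ u₂ v₂ s) = pencil F n d := by
  classical
  funext i
  set χ₀ : F := ind ((lab (i 0) 0 : ℕ) < 1) with hχ₀
  set χ₁ : F := ind ((lab (i 1) 0 : ℕ) < 1) with hχ₁
  set χ₂ : F := ind ((lab (i 2) 2 : ℕ) < d) with hχ₂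
  set X : Fin r₁ → F := fun k => w₁ k (lab (i 0) 1, lab (i 0) 2) *
    extMid (u₁ k) (lab (i 2) 0) (modLab d₁ (lab (i 2) 2)) *
      extFst (v₁ k) (modLab d₁ (lab (i 3) 2)) (lab (i 3) 0) with hX
  set Y : Fin r₂ → F := fun k => w₂ k (lab (i 1) 1, lab (i 1) 2) *
    extMid (u₂ k) (lab (i 2) 1) (divLab d₁ (lab (i 2) 2)) *
      extFst (v₂ k) (divLab d₁ (lab (i 3) 2)) (lab (i 3) 1) with hY
  have hterm : ∀ s : Fin r₁ × Fin r₂, rankOneTensor (twoTriLeg d w₁ u₁ v₁ w₂ u₂ v₂ s) i =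
      χ₀ * χ₁ * χ₂ * X s.1 * Y s.2 := by
    rintro ⟨k, k'⟩
    rw [rankOneTensor_apply, Fin.prod_univ_four]
    simp only [twoTriLeg, Matrix.cons_val_zero, Matrix.cons_val_one, Matrix.cons_val_two,
      Matrix.cons_val_three, Matrix.head_cons, Matrix.tail_cons, hX, hY, hχ₀, hχ₁, hχ₂]
    ring
  have hsumX : ∑ k, X k = ind ((((modLab d₁ (lab (i 2) 2) : Fin n) : ℕ) < d₁) ∧
      (lab (i 0) 1 = lab (i 2) 0 ∧ modLab d₁ (lab (i 2) 2) = modLab d₁ (lab (i 3) 2) ∧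
        lab (i 0) 2 = lab (i 3) 0)) :=
    sum_triad_ext hdec₁ _ _ _ _ _
  have hsumY : ∑ k, Y k = ind ((((divLab d₁ (lab (i 2) 2) : Fin n) : ℕ) < d₂) ∧
      (lab (i 1) 1 = lab (i 2) 1 ∧ divLab d₁ (lab (i 2) 2) = divLab d₁ (lab (i 3) 2) ∧
        lab (i 1) 2 = lab (i 3) 1)) :=
    sum_triad_ext hdec₂ _ _ _ _ _
  calc (∑ s : Fin r₁ × Fin r₂, rankOneTensor (twoTriLeg d w₁ u₁ v₁ w₂ u₂ v₂ s)) i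
      = ∑ s : Fin r₁ × Fin r₂, χ₀ * χ₁ * χ₂ * X s.1 * Y s.2 := by
        rw [Finset.sum_apply]
        exact Finset.sum_congr rfl fun s _ => hterm s
    _ = ∑ k : Fin r₁, ∑ k' : Fin r₂, χ₀ * χ₁ * χ₂ * X k * Y k' := by
        rw [Fintype.sum_prod_type]
    _ = (χ₀ * χ₁ * χ₂) * (∑ k, X k) * (∑ k', Y k') := by
        simp only [Finset.mul_sum, Finset.sum_mul]
        exact Finset.sum_comm
    _ = pencil F n d i := by
        rw [hsumX, hsumY, hχ₀, hχ₁, hχ₂, pencil_apply, ind_mul_ind, ind_mul_ind, ind_mul_ind,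
          ind_mul_ind]
        simp only [ind, coe_modLab, coe_divLab]
        refine if_congr ?_ rfl rfl
        constructor
        · rintro ⟨⟨⟨⟨h00, h10⟩, h22d⟩, -, h0120, hmod, h0230⟩, -, h1121, hdiv, h1231⟩
          refine ⟨⟨h00, h22d⟩, Fin.ext (by omega), h0120, h0230, h1121, h1231, ?_⟩
          exact (modLab_eq_and_divLab_eq_iff d₁ _ _).1 ⟨hmod, hdiv⟩
        · rintro ⟨⟨h00, h22d⟩, h0010, h0120, h0230, h1121, h1231, h2232⟩
          have hlt : ((lab (i 2) 2 : Fin n) : ℕ) < d₁ * d₂ := lt_of_lt_of_le h22d hd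
          have hd₁ : 0 < d₁ := by
            rcases Nat.eq_zero_or_pos d₁ with h | h
            · rw [h, Nat.zero_mul] at hlt
              exact absurd hlt (Nat.not_lt_zero _)
            · exact h
          refine ⟨⟨⟨⟨h00, ?_⟩, h22d⟩, Nat.mod_lt _ hd₁, h0120, ?_, h0230⟩, ?_, h1121, ?_, h1231⟩
          · rw [← h0010]; exact h00
          · rw [h2232]
          · exact (Nat.div_lt_iff_lt_mul hd₁).2 (by rwa [Nat.mul_comm] at hlt)
          · rw [h2232]

/-- **Two-triangle bound** `R₄(P_n^{(d)}) ≤ R(⟨n, d₁, n⟩) · R(⟨n, d₂, n⟩)` for `d ≤ d₁ d₂`: the pencil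
is (a restriction of) the Kronecker product of the rectangular triangles `023` and `123`.
[cite: ChristandlVranaZuiddam2016, Prop. 1.1.16, Prop. 1.1.26] -/
theorem tensorRankD_pencil_le_twoTriangles {n d d₁ d₂ : ℕ} (hd : d ≤ d₁ * d₂) :
    tensorRankD (pencil F n d) ≤
      tensorRank (matMulTensor F n d₁ n) * tensorRank (matMulTensor F n d₂ n) := by
  classical
  obtain ⟨w₁, u₁, v₁, hdec₁⟩ := exists_triad_decomposition_tensorRank (matMulTensor F n d₁ n)
  obtain ⟨w₂, u₂, v₂, hdec₂⟩ := exists_triad_decomposition_tensorRank (matMulTensor F n d₂ n)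
  have hsum := pencil_eq_sum_twoTriangles hd hdec₁ hdec₂
  have hcard : Fintype.card (Fin (tensorRank (matMulTensor F n d₁ n)) ×
      Fin (tensorRank (matMulTensor F n d₂ n))) =
      tensorRank (matMulTensor F n d₁ n) * tensorRank (matMulTensor F n d₂ n) := by simp
  rw [← hcard]
  let e := Fintype.equivFin
    (Fin (tensorRank (matMulTensor F n d₁ n)) × Fin (tensorRank (matMulTensor F n d₂ n)))
  refine tensorRankD_le_of_eq_sum (fun k => twoTriLeg d w₁ u₁ v₁ w₂ u₂ v₂ (e.symm k)) ?_
  rw [← hsum]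
  exact Fintype.sum_equiv e.symm _ _ (fun _ => rfl)

/-- **Square split** `R₄(P_n^{(d)}) ≤ R(⟨n, e, n⟩)²` for `d ≤ e²`; at `d = n`, `e = ⌈√n⌉`:
`R₄(T(K₄ - e)_n) ≤ R(⟨n, ⌈√n⌉, n⟩)²`. [cite: ChristandlVranaZuiddam2016, Prop. 1.1.26] -/
theorem tensorRankD_pencil_le_sq {n d e : ℕ} (hd : d ≤ e * e) :
    tensorRankD (pencil F n d) ≤ tensorRank (matMulTensor F n e n) ^ 2 := by
  rw [sq]
  exact tensorRankD_pencil_le_twoTriangles hd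

end TwoTriangles

/-! ## §2 The pencil exponent is rectangular: `ψ(ε) = ω(2,ε,2) = 2·ω(1,ε/2,1)` -/

section Exponent

variable (F : Type) [Field F]

/-- `⌈n^ε⌉ ≤ ⌈n^{ε/2}⌉²` for `n ≥ 1`. [folklore] -/
theorem rectDim_le_rectDim_half_sq {n : ℕ} (hn : 1 ≤ n) (ε : ℝ) :
    rectDim n ε ≤ rectDim n (ε / 2) * rectDim n (ε / 2) := by
  have hn' : (0 : ℝ) < n := by exact_mod_cast hn
  show ⌈(n : ℝ) ^ ε⌉₊ ≤ rectDim n (ε / 2) * rectDim n (ε / 2)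
  refine Nat.ceil_le.2 ?_
  calc (n : ℝ) ^ ε = (n : ℝ) ^ (ε / 2) * (n : ℝ) ^ (ε / 2) := by
        rw [← Real.rpow_add hn']; ring_nf
    _ ≤ (rectDim n (ε / 2) : ℝ) * (rectDim n (ε / 2) : ℝ) :=
        mul_le_mul (Nat.le_ceil _) (Nat.le_ceil _) (Real.rpow_nonneg hn'.le _) (Nat.cast_nonneg _)
    _ = ((rectDim n (ε / 2) * rectDim n (ε / 2) : ℕ) : ℝ) := by push_cast; rfl

/-- Two-triangle cover in exponents: `β` admissible for `⟨n, ⌈n^{ε/2}⌉, n⟩` ⟹ `2β` admissible for the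
pencil family. -/
theorem two_mul_mem_pencilAdmissibleExponents {ε β : ℝ}
    (hβ : β ∈ rectAdmissibleExponents F 1 (ε / 2) 1) : 2 * β ∈ pencilAdmissibleExponents F ε := by
  obtain ⟨C, hC0, hC⟩ := bound_of_isBigO_nat_atTop hβ
  refine IsBigO.of_bound (C ^ 2) ?_
  filter_upwards [eventually_ge_atTop 1] with n hn
  have hn0 : (0 : ℝ) < n := by exact_mod_cast hn
  have hR : (tensorRank (matMulTensor F n (rectDim n (ε / 2)) n) : ℝ) ≤ C * (n : ℝ) ^ β := by
    have h := hC (Real.rpow_pos_of_pos hn0 β).ne'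
    rwa [Real.norm_of_nonneg (Nat.cast_nonneg _), Real.norm_of_nonneg (Real.rpow_nonneg hn0.le _),
      tensorRank_matMulTensor_congr F (rectDim_one n) rfl (rectDim_one n)] at h
  have hpow : (n : ℝ) ^ (2 * β) = ((n : ℝ) ^ β) ^ 2 := by
    rw [mul_comm, Real.rpow_mul hn0.le, Real.rpow_two]
  rw [Real.norm_of_nonneg (Nat.cast_nonneg _), Real.norm_of_nonneg (Real.rpow_nonneg hn0.le _), hpow]
  have hfin := tensorRankD_pencil_le_sq (F := F) (n := n) (rectDim_le_rectDim_half_sq hn ε)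
  have hR0 : (0 : ℝ) ≤ (tensorRank (matMulTensor F n (rectDim n (ε / 2)) n) : ℝ) := Nat.cast_nonneg _
  calc (tensorRankD (pencil F n (rectDim n ε)) : ℝ)
      ≤ (tensorRank (matMulTensor F n (rectDim n (ε / 2)) n) : ℝ) ^ 2 := by exact_mod_cast hfin
    _ ≤ (C * (n : ℝ) ^ β) ^ 2 := pow_le_pow_left₀ hR0 hR 2
    _ = C ^ 2 * ((n : ℝ) ^ β) ^ 2 := by ring

/-- **`ψ(ε) ≤ 2·ω(1, ε/2, 1)`** (`ε ≤ 1`): the two-triangle cover with the symmetric split.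
[cite: ChristandlVranaZuiddam2016, Prop. 1.1.26] -/
theorem omegaPencil_le_two_mul_omegaRect_half {ε : ℝ} (hε1 : ε ≤ 1) :
    omegaPencil F ε ≤ 2 * omegaRect F 1 (ε / 2) 1 := by
  have h : ∀ β ∈ rectAdmissibleExponents F 1 (ε / 2) 1, omegaPencil F ε / 2 ≤ β := fun β hβ => by
    have h2 := csInf_le (pencilAdmissibleExponents_bddBelow F hε1)
      (two_mul_mem_pencilAdmissibleExponents F hβ)
    change omegaPencil F ε ≤ 2 * β at h2
    linarith
  have h3 := le_csInf (rectAdmissibleExponents_nonempty F 1 (ε / 2) 1) h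
  change omegaPencil F ε / 2 ≤ omegaRect F 1 (ε / 2) 1 at h3
  linarith

/-- Homogeneity `ω(2, ε, 2) = 2·ω(1, ε/2, 1)` (`0 ≤ ε`). [cite: LottiRomani1983, §3] -/
theorem omegaRect_two_mid_two_eq_two_mul {ε : ℝ} (hε0 : 0 ≤ ε) :
    omegaRect F 2 ε 2 = 2 * omegaRect F 1 (ε / 2) 1 := by
  have hs := omegaRect_smul (K := F) (t := 2) (by norm_num) (a := 1) (b := ε / 2) (c := 1)
    (by norm_num) (by linarith) (by norm_num)
  have h2 : ((2 : ℕ) : ℝ) * (ε / 2) = ε := by push_cast; ring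
  have h1 : ((2 : ℕ) : ℝ) * 1 = 2 := by norm_num
  have h22 : ((2 : ℕ) : ℝ) = 2 := by norm_num
  rw [h2, h1, h22] at hs
  exact hs

/-- **THE PENCIL IS RECTANGULAR: `ψ(ε) = 2·ω(1, ε/2, 1)`** (`0 ≤ ε ≤ 1`). The grouping floor
`ω(2,ε,2) ≤ ψ(ε)` (`EdgePencilExponent`) and the two-triangle cover coincide.
[cite: ChristandlVranaZuiddam2016, Prop. 1.1.26; LottiRomani1983, §3] -/
theorem omegaPencil_eq_two_mul_omegaRect_half {ε : ℝ} (hε0 : 0 ≤ ε) (hε1 : ε ≤ 1) :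
    omegaPencil F ε = 2 * omegaRect F 1 (ε / 2) 1 := by
  refine le_antisymm (omegaPencil_le_two_mul_omegaRect_half F hε1) ?_
  rw [← omegaRect_two_mid_two_eq_two_mul F hε0]
  exact omegaRect_two_mid_two_le_omegaPencil F hε1

/-- **`ψ(ε) = ω(2, ε, 2)`** (`0 ≤ ε ≤ 1`): the exponent of the weighted diamond `K₄ - e` (4-cycle of weight
`1`, remaining edge of weight `ε`) is the rectangular exponent `ω(2, ε, 2)`. -/
theorem omegaPencil_eq_omegaRect_two_mid_two {ε : ℝ} (hε0 : 0 ≤ ε) (hε1 : ε ≤ 1) :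
    omegaPencil F ε = omegaRect F 2 ε 2 := by
  rw [omegaPencil_eq_two_mul_omegaRect_half F hε0 hε1, omegaRect_two_mid_two_eq_two_mul F hε0]

/-- **The diamond exponent** `ψ(1) = ω(2,1,2) = 2·ω(1,1/2,1)` (`T(K₄ - e)`, all bonds `n`). -/
theorem omegaPencil_one_eq : omegaPencil F 1 = 2 * omegaRect F 1 (1 / 2) 1 :=
  omegaPencil_eq_two_mul_omegaRect_half F (by norm_num) le_rfl

/-- `ψ(1) = ω(2,1,2)`. -/
theorem omegaPencil_one_eq_omegaRect_two_one_two : omegaPencil F 1 = omegaRect F 2 1 2 :=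
  omegaPencil_eq_omegaRect_two_mid_two F (by norm_num) le_rfl

/-- **Exact rung frontier `ψ(ε) ≤ 4 ⟺ ε/2 ≤ α`** (`0 ≤ ε ≤ 1`): the window
`[α, 2α]` of `EdgePencilExponent.omegaPencil_rung_window` closes at its upper end; the pencil is flat
exactly on `[0, min(2α, 1)]`. [cite: LeGall2012, §1] -/
theorem omegaPencil_le_four_iff_half_le_dualExponentAlpha {ε : ℝ} (hε0 : 0 ≤ ε) (hε1 : ε ≤ 1) :
    omegaPencil F ε ≤ 4 ↔ ε / 2 ≤ dualExponentAlpha F := by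
  refine ⟨half_eps_le_dualExponentAlpha_of_omegaPencil_le_four F hε0 hε1, fun h => ?_⟩
  rw [omegaPencil_eq_two_mul_omegaRect_half F hε0 hε1, omegaRect_eq_two_of_le_dualExponentAlpha F h]
  norm_num

/-- **`DiamondFlat ⟺ α ≥ 1/2`**: the attacked leaf of the diamond cut, `ψ(1) ≤ 4`, IS the classical
statement `ω(1, 1/2, 1) = 2`, i.e. `dualExponentAlpha ≥ 1/2`. [cite: LeGall2012, §1] -/
theorem diamondFlat_iff_half_le_dualExponentAlpha :
    omegaPencil F 1 ≤ 4 ↔ 1 / 2 ≤ dualExponentAlpha F :=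
  omegaPencil_le_four_iff_half_le_dualExponentAlpha F (by norm_num) le_rfl

/-- **The cover-priced diamond residual is a costume** (given `α > 0`): `ω + 2 ≤ ψ(1) = 2·ω(1,1/2,1)`
puts the midpoint of the convex profile `k ↦ ω(1,k,1)` on its chord over `[0,1]`; with the flat segment
`[0, α]`, `α > 0`, this forces `ω = 2` (`EdgePencilExponent.omega_eq_two_of_chord_le_omegaRect` at
`ε = 1/2`). The hypothesis `0 < α` is Coppersmith 1982 (`0.1722 < α`, Literature
`coppersmith1982_dualExponentAlpha_gt`). [cite: Coppersmith1982, Thm 1] -/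
theorem omega_eq_two_of_diamondNoSaving (hα0 : 0 < dualExponentAlpha F)
    (h : omega F + 2 ≤ omegaPencil F 1) : omega F = 2 := by
  rw [omegaPencil_one_eq] at h
  exact omega_eq_two_of_chord_le_omegaRect F hα0 (ε := 1 / 2) (by norm_num) (by norm_num)
    (by linarith)

/-- `ω + 2 ≤ ψ(1) ⟺ ω = 2` over `ℂ` (given `α > 0`): the re-priced residual of the diamond cut is
summit-equivalent. [cite: Coppersmith1982, Thm 1] -/
theorem diamondNoSaving_iff_matrixMultiplication (hα0 : 0 < dualExponentAlpha ℂ) :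
    omega ℂ + 2 ≤ omegaPencil ℂ 1 ↔ _root_.MatrixMultiplication := by
  refine ⟨fun h => _root_.MatrixMultiplication_iff.2 (omega_eq_two_of_diamondNoSaving ℂ hα0 h),
    fun hS => ?_⟩
  exact ((matrixMultiplication_iff_diamond).1 hS).2

/-- **The diamond cut degenerates** (given `α > 0`): its attacked leaf is `α ≥ 1/2` and its residual is
the summit — `ω = 2 ⟺ (α ≥ 1/2) ∧ [costume]`. Among the spanning subgraphs of `K₄` only the full
tetrahedron (`TetraFlat`, route `TetrahedronCarving`) carries a non-rectangular flatness leaf. -/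
theorem diamondCut_degenerates (hα0 : 0 < dualExponentAlpha ℂ) :
    (omegaPencil ℂ 1 ≤ 4 ↔ 1 / 2 ≤ dualExponentAlpha ℂ) ∧
      (omega ℂ + 2 ≤ omegaPencil ℂ 1 ↔ _root_.MatrixMultiplication) :=
  ⟨diamondFlat_iff_half_le_dualExponentAlpha ℂ, diamondNoSaving_iff_matrixMultiplication hα0⟩

/-- `ω = 2 ⟺ α ≥ 1/2 ∧ ω + 2 ≤ ψ(1)` — the diamond cut rewritten through `ψ(1) = 2ω(1,1/2,1)`
(unconditional; the second conjunct is the costume). -/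
theorem matrixMultiplication_iff_half_le_alpha_and_diamondNoSaving :
    _root_.MatrixMultiplication ↔
      1 / 2 ≤ dualExponentAlpha ℂ ∧ omega ℂ + 2 ≤ omegaPencil ℂ 1 := by
  rw [matrixMultiplication_iff_diamond, diamondFlat_iff_half_le_dualExponentAlpha]

/-- **`TetraFlat ⟹ α ≥ 1/2` recovered through the diamond**: `ω(K₄) ≤ 4 ⟹ ψ(1) ≤ 4 ⟺ α ≥ 1/2`; the
diamond captures exactly this classical shadow of the leaf and nothing more. -/
theorem half_le_dualExponentAlpha_of_tetraFlat
    (h : Summit.MatrixMultiplication.MatrixMultiplication.Theses.TetrahedronCarving.TetraFlat) :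
    1 / 2 ≤ dualExponentAlpha ℂ :=
  (diamondFlat_iff_half_le_dualExponentAlpha ℂ).1 (omegaPencil_le_four_of_tetraFlat h le_rfl)

/-- The gap between the leaf of record and the diamond in exponents: `ω(K₄) − ψ(1) = ω(K₄) − ω(2,1,2)
∈ [0, 2ω − ω(2,1,2)]`; `TetraFlat` asks `ω(K₄) = ω(2,1,2) = 4`, i.e. BOTH `α ≥ 1/2` AND that gluing the
sixth edge onto the flat diamond costs nothing. -/
theorem omegaTetra_sub_omegaPencil_one :
    0 ≤ omegaTetra F - omegaPencil F 1 ∧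
      omegaTetra F - omegaPencil F 1 ≤ 2 * omega F - omegaRect F 2 1 2 := by
  refine ⟨sub_nonneg.2 (omegaPencil_le_omegaTetra F le_rfl), ?_⟩
  rw [omegaPencil_one_eq_omegaRect_two_one_two]
  linarith [omegaTetra_le_two_mul_omega F]

end Exponent

end Summit.MatrixMultiplication.MatrixMultiplication.Theorems.EdgePencil

end
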